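import Summits.FinalStateConjecture.FinalStateConjecture.Theses.PhaseMixingCapture

/-!
# `KappaExplicitWaveDecay` (crux `stmt-FinalStateConjecture-10654`, route `PhaseMixingCapture`):
# the wave equation is load-bearing (negative-side support, cdisprove seat)

The statement negated by `kappaExplicitWaveDecay_false_without_waveEq` (written inline, so that no
proposition is defined under `Summits/`; the witness functions `Witness.prof/Psi/psi` ARE definitions,
reusable by other seats) is the crux
`Summit.FinalStateConjecture.FinalStateConjecture.Theses.PhaseMixingCapture.KappaExplicitWaveDecay`
with the clause `∀ x, □_g ψ x = 0` deleted from the admissibility hypothesis of both conjuncts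
(the instance binders `[Kerr.Facts] [Kerr.SliceFacts]`, which only feed the metric of that clause,
are dropped with it; everything else is verbatim). It is FALSE, sorry-free:

* `kappaExplicitWaveDecay_false_without_waveEq` — on the
  Schwarzschild exterior `M = 1, a = 0` (`= {‖y‖ > 2}` in Kerr–Schild coordinates) the smooth
  function `ψ(t*, y) = expNegInvGlue (t* - 1/3)` vanishes identically on `{t* < 1/3}`, so its data on
  the initial leaf vanish with all derivatives (`E_j[ψ](0) = 0` for every `j`, compact set `K = ∅`),
  while `sliceEnergy ψ τ₀ > 0` at a time `τ₀ ∈ (1/3, 4/3)` where `ψ' (τ₀) > 0` (mean value theorem):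
  clause (a) fails for every `(p, j, C)`.

Moral for provers: the wave equation must be used to transport vanishing / size of the data off the
initial leaf `{t* = 0} ∩ {r > r₊}` (domain of dependence, energy identity); nothing else in the
hypotheses constrains `ψ` at `t* = τ > 0`.
-/

noncomputable section

namespace Summit.FinalStateConjecture.FinalStateConjecture.Theorems.KappaExplicitWaveDecay.Negative

open Literature.Geometry.Lorentzian
open scoped Manifold ENNReal Topology ContDiff
open Filter Set MeasureTheory

namespace Witness

/-! ### The witness: `ψ(t*, y) = expNegInvGlue (t* - 1/3)` on Schwarzschild `M = 1, a = 0` -/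

/-- Time profile: vanishes for `t ≤ 1/3`, positive after. -/
def prof (t : ℝ) : ℝ := expNegInvGlue (t - 1 / 3)

/-- The profile is `C^∞` (composition of `expNegInvGlue` with a translation). [folklore] -/
theorem prof_contDiff : ContDiff ℝ ∞ prof :=
  expNegInvGlue.contDiff.comp (contDiff_id.sub contDiff_const)

/-- The profile vanishes for `t ≤ 1/3`. [folklore] -/
theorem prof_eq_zero {t : ℝ} (ht : t ≤ 1 / 3) : prof t = 0 :=
  expNegInvGlue.zero_of_nonpos (by linarith)

/-- The profile is differentiable. [folklore] -/
theorem prof_differentiable : Differentiable ℝ prof :=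
  prof_contDiff.differentiable (by simp)

/-- A time `τ₀ ∈ (1/3, 4/3)` with `prof' τ₀ > 0` (mean value theorem; no closed form needed). -/
theorem exists_deriv_prof_pos : ∃ τ₀ : ℝ, 0 ≤ τ₀ ∧ 0 < deriv prof τ₀ := by
  obtain ⟨c, hc, hderiv⟩ := exists_deriv_eq_slope prof (show (1 / 3 : ℝ) < 4 / 3 by norm_num)
    prof_contDiff.continuous.continuousOn (prof_differentiable.differentiableOn)
  refine ⟨c, by linarith [hc.1], ?_⟩
  rw [hderiv, prof_eq_zero le_rfl]
  have : 0 < prof (4 / 3) := expNegInvGlue.pos_of_pos (by norm_num)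
  exact div_pos (by linarith) (by norm_num)

/-- The time coordinate `x ↦ x 0` is `C^∞` on `E4`. [folklore] -/
theorem contDiff_coord_zero : ContDiff ℝ ∞ (fun x : E4 ↦ x 0) := by
  simpa using (EuclideanSpace.proj (𝕜 := ℝ) (0 : Fin 4)).contDiff

/-- The time coordinate has derivative the projection `proj 0`. [folklore] -/
theorem hasFDerivAt_coord_zero (x : E4) :
    HasFDerivAt (fun x : E4 ↦ x 0) (EuclideanSpace.proj (𝕜 := ℝ) (0 : Fin 4)) x := by
  simpa using (EuclideanSpace.proj (𝕜 := ℝ) (0 : Fin 4)).hasFDerivAt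

/-- The ambient witness `Ψ(x) = prof (x 0)`. -/
def Psi (x : E4) : ℝ := prof (x 0)

/-- `Ψ` is `C^∞`. [folklore] -/
theorem Psi_contDiff : ContDiff ℝ ∞ Psi :=
  prof_contDiff.comp contDiff_coord_zero

/-- `Ψ` vanishes on `{x 0 ≤ 1/3}`. [folklore] -/
theorem Psi_eq_zero {x : E4} (hx : x 0 ≤ 1 / 3) : Psi x = 0 := prof_eq_zero hx

/-- Chain rule for `Ψ = prof ∘ (x ↦ x 0)`. [folklore] -/
theorem hasFDerivAt_Psi (x : E4) :
    HasFDerivAt Psi (deriv prof (x 0) • (EuclideanSpace.proj (0 : Fin 4) : E4 →L[ℝ] ℝ)) x :=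
  (prof_differentiable (x 0)).hasDerivAt.comp_hasFDerivAt x (hasFDerivAt_coord_zero x)

/-- `∂_{t*} Ψ (x) = prof' (x 0)`. [folklore] -/
theorem fderiv_Psi_single_zero (x : E4) :
    fderiv ℝ Psi x (EuclideanSpace.single 0 1) = deriv prof (x 0) := by
  rw [(hasFDerivAt_Psi x).fderiv]
  simp

/-- The witness on the Schwarzschild exterior `M = 1`, `a = 0`. -/
def psi (x : Kerr.exterior 1 0) : ℝ := Psi x.1

/-- The witness is `C^∞` on the open submanifold `Kerr.exterior 1 0`. [folklore] -/
theorem psi_contMDiff : ContMDiff 𝓘(ℝ, E4) 𝓘(ℝ, ℝ) ∞ psi :=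
  Psi_contDiff.contMDiff.comp contMDiff_subtype_val

/-- On the exterior the zero-extension of the witness is `Ψ`. [folklore] -/
theorem extend_psi_of_mem {x : E4} (h : x ∈ Kerr.exterior 1 0) :
    Function.extend Subtype.val psi (0 : E4 → ℝ) x = Psi x :=
  Subtype.val_injective.extend_apply _ _ (⟨x, h⟩ : Kerr.exterior 1 0)

/-- Off the exterior the zero-extension of the witness is `0`. [folklore] -/
theorem extend_psi_of_not_mem {x : E4} (h : x ∉ Kerr.exterior 1 0) :
    Function.extend Subtype.val psi (0 : E4 → ℝ) x = 0 := by
  rw [Function.extend_apply']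
  · rfl
  · rintro ⟨y, rfl⟩
    exact h y.2

/-- Near the initial leaf the zero-extension vanishes identically. -/
theorem extend_psi_eq_zero {x : E4} (hx : x 0 ≤ 1 / 3) :
    Function.extend Subtype.val psi (0 : E4 → ℝ) x = 0 := by
  by_cases h : x ∈ Kerr.exterior 1 0
  · rw [extend_psi_of_mem h]
    exact Psi_eq_zero hx
  · exact extend_psi_of_not_mem h

/-- On the open set `{x 0 < 1/3}` the zero-extension is locally the zero function. [folklore] -/
theorem extend_psi_eventuallyEq_zero {x : E4} (hx : x 0 < 1 / 3) :
    Function.extend Subtype.val psi (0 : E4 → ℝ) =ᶠ[𝓝 x] fun _ ↦ 0 := by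
  have hopen : IsOpen {y : E4 | y 0 < 1 / 3} :=
    isOpen_lt (EuclideanSpace.proj (0 : Fin 4)).continuous continuous_const
  filter_upwards [hopen.mem_nhds hx] with y hy
  exact extend_psi_eq_zero (le_of_lt hy)

/-- All derivatives of the zero-extended witness vanish on the initial leaf: `E_j[ψ](0) = 0`. -/
theorem iteratedFDeriv_extend_psi_slice (m : ℕ) (y : E3) :
    iteratedFDeriv ℝ m (Function.extend Subtype.val psi (0 : E4 → ℝ)) (E4.ofTimeSpace 0 y) = 0 := by
  have h := (extend_psi_eventuallyEq_zero (x := E4.ofTimeSpace 0 y) (by simp)).iteratedFDeriv ℝ m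
  rw [h.self_of_nhds]
  simp

/-- On the (open) exterior the zero-extension agrees with `Ψ` near every point. -/
theorem extend_psi_eventuallyEq {x : E4} (hx : x ∈ Kerr.exterior 1 0) :
    Function.extend Subtype.val psi (0 : E4 → ℝ) =ᶠ[𝓝 x] Psi := by
  filter_upwards [(Kerr.exterior 1 0).isOpen.mem_nhds hx] with y hy
  exact extend_psi_of_mem hy

/-- The Schwarzschild exterior `M = 1`, `a = 0` is `{‖y‖ > 2}`. -/
theorem mem_exterior_one_zero {x : E4} : x ∈ Kerr.exterior 1 0 ↔ 2 < E4.spatialNorm x := by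
  rw [Kerr.mem_exterior, Kerr.radius_zero_left, Kerr.rPlus_zero_right zero_le_one, max_lt_iff]
  constructor
  · rintro ⟨h, -⟩; linarith
  · intro h; exact ⟨by linarith, by linarith⟩

/-- The leaf `{t* = τ}` of the Schwarzschild exterior `M = 1, a = 0` is `{‖y‖ > 2}`. [folklore] -/
theorem sliceSet_eq (τ : ℝ) :
    {y : E3 | E4.ofTimeSpace τ y ∈ Kerr.exterior 1 0} = {y | 2 < ‖y‖} := by
  ext y
  simp only [Set.mem_setOf_eq, mem_exterior_one_zero, E4.spatialNorm_ofTimeSpace]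

/-- Energy density of the witness at `(τ, y)` in the exterior is at least `prof'(τ)²`. -/
theorem coordEnergyDensity_ge {τ : ℝ} {y : E3} (hy : E4.ofTimeSpace τ y ∈ Kerr.exterior 1 0) :
    deriv prof τ ^ 2 ≤ coordEnergyDensity (Kerr.exterior 1 0) psi (E4.ofTimeSpace τ y) := by
  unfold coordEnergyDensity
  have h0 : (fderiv ℝ (Function.extend Subtype.val psi (0 : E4 → ℝ)) (E4.ofTimeSpace τ y)
      (EuclideanSpace.single 0 (1 : ℝ))) ^ 2 = deriv prof τ ^ 2 := by
    rw [(extend_psi_eventuallyEq hy).fderiv_eq, fderiv_Psi_single_zero]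
    simp
  rw [← h0]
  exact Finset.single_le_sum (f := fun μ : Fin 4 ↦ (fderiv ℝ (Function.extend Subtype.val psi
    (0 : E4 → ℝ)) (E4.ofTimeSpace τ y) (EuclideanSpace.single μ (1 : ℝ))) ^ 2)
    (fun i _ ↦ sq_nonneg _) (Finset.mem_univ 0)

/-- The witness has positive (indeed infinite) slice energy whenever `prof'(τ) > 0`. -/
theorem sliceEnergy_pos {τ : ℝ} (hτ : 0 < deriv prof τ) :
    0 < sliceEnergy (Kerr.exterior 1 0) psi τ := by
  unfold sliceEnergy
  have hS : MeasurableSet {y : E3 | E4.ofTimeSpace τ y ∈ Kerr.exterior 1 0} :=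
    ((Kerr.exterior 1 0).isOpen.preimage (E4.continuous_ofTimeSpace τ)).measurableSet
  have hle : {y : E3 | E4.ofTimeSpace τ y ∈ Kerr.exterior 1 0}.indicator
      (fun _ ↦ ENNReal.ofReal (deriv prof τ ^ 2)) ≤
      {y : E3 | E4.ofTimeSpace τ y ∈ Kerr.exterior 1 0}.indicator
      (fun y ↦ ENNReal.ofReal (coordEnergyDensity (Kerr.exterior 1 0) psi (E4.ofTimeSpace τ y))) := by
    intro y
    by_cases hy : E4.ofTimeSpace τ y ∈ Kerr.exterior 1 0
    · have hy' : y ∈ {y : E3 | E4.ofTimeSpace τ y ∈ Kerr.exterior 1 0} := hy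
      rw [Set.indicator_of_mem hy', Set.indicator_of_mem hy']
      exact ENNReal.ofReal_le_ofReal (coordEnergyDensity_ge hy)
    · have hy' : y ∉ {y : E3 | E4.ofTimeSpace τ y ∈ Kerr.exterior 1 0} := hy
      rw [Set.indicator_of_notMem hy', Set.indicator_of_notMem hy']
  refine lt_of_lt_of_le ?_ (lintegral_mono hle)
  rw [lintegral_indicator_const hS]
  refine ENNReal.mul_pos (ENNReal.ofReal_pos.2 (by positivity)).ne' ?_
  have hopen : IsOpen {y : E3 | E4.ofTimeSpace τ y ∈ Kerr.exterior 1 0} :=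
    (Kerr.exterior 1 0).isOpen.preimage (E4.continuous_ofTimeSpace τ)
  refine (hopen.measure_pos volume ⟨EuclideanSpace.single 0 3, ?_⟩).ne'
  rw [sliceSet_eq, Set.mem_setOf_eq, EuclideanSpace.single, PiLp.norm_single, Real.norm_eq_abs]
  norm_num

/-- Near a point of the exterior with `t* < 1/3` the witness is locally zero. [folklore] -/
theorem psi_eventuallyEq_zero {x : Kerr.exterior 1 0} (hx : (x : E4) 0 < 1 / 3) :
    psi =ᶠ[𝓝 x] fun _ ↦ 0 := by
  have hcont : Continuous fun x' : Kerr.exterior 1 0 ↦ (x' : E4) 0 :=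
    contDiff_coord_zero.continuous.comp continuous_subtype_val
  have hopen : IsOpen {x' : Kerr.exterior 1 0 | (x' : E4) 0 < 1 / 3} :=
    isOpen_lt hcont continuous_const
  filter_upwards [hopen.mem_nhds hx] with x' hx'
  exact Psi_eq_zero (le_of_lt hx')

/-- The differential of the witness vanishes on the initial leaf `{t* = 0}`. [folklore] -/
theorem mfderiv_psi_eq_zero {x : Kerr.exterior 1 0} (hx : (x : E4) 0 = 0) :
    mfderiv 𝓘(ℝ, E4) 𝓘(ℝ, ℝ) psi x = 0 := by
  rw [(psi_eventuallyEq_zero (x := x) (by rw [hx]; norm_num)).mfderiv_eq]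
  exact mfderiv_const

/-- The witness satisfies every admissibility clause except the wave equation (with `K = ∅`). -/
theorem psi_smooth_and_compactData :
    ContMDiff 𝓘(ℝ, E4) 𝓘(ℝ, ℝ) ((⊤ : ℕ∞) : WithTop ℕ∞) psi ∧
      ∃ K : Set (Kerr.exterior 1 0), IsCompact K ∧ ∀ x : Kerr.exterior 1 0, (x : E4) 0 = 0 →
        x ∉ K → psi x = 0 ∧ mfderiv 𝓘(ℝ, E4) 𝓘(ℝ, ℝ) psi x = 0 :=
  ⟨psi_contMDiff, ∅, isCompact_empty, fun x hx _ ↦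
    ⟨Psi_eq_zero (by rw [hx]; norm_num), mfderiv_psi_eq_zero hx⟩⟩

/-- `E_j[ψ](0) = 0` for every `j`. -/
theorem initEnergy_psi_eq_zero (j : ℕ) :
    (∫⁻ y : E3, {y | E4.ofTimeSpace 0 y ∈ Kerr.exterior 1 0}.indicator (fun y ↦
      ENNReal.ofReal (∑ m ∈ Finset.range (j + 1), ‖iteratedFDeriv ℝ m (Function.extend Subtype.val
        psi (0 : E4 → ℝ)) (E4.ofTimeSpace 0 y)‖ ^ 2)) y) = 0 := by
  simp [iteratedFDeriv_extend_psi_slice]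

end Witness

open Witness in
/-- **The wave equation is load-bearing in `KappaExplicitWaveDecay`.** With the clause `□_g ψ = 0`
deleted, clause (a) fails on Schwarzschild `(M, a) = (1, 0)` for every `(p, j, C)`: the witness
`ψ(t*, y) = expNegInvGlue (t* - 1/3)` has `E_j[ψ](0) = 0` (RHS `= 0`) and `sliceEnergy ψ τ₀ > 0`.
[folklore] -/
theorem kappaExplicitWaveDecay_false_without_waveEq : ¬ (
    ∀ M : ℝ, 0 < M → ∃ (p : ℝ) (j : ℕ), (∃ C : ENNReal, C < ⊤ ∧ ∀ a : ℝ, Literature.Geometry.Lorentzian.Kerr.IsSubextremal M a → ∀ ψ : Literature.Geometry.Lorentzian.Kerr.exterior M a → ℝ, (ContMDiff 𝓘(ℝ, Literature.Geometry.Lorentzian.E4) 𝓘(ℝ, ℝ) ((⊤ : ℕ∞) : WithTop ℕ∞) ψ ∧ ∃ K : Set (Literature.Geometry.Lorentzian.Kerr.exterior M a), IsCompact K ∧ ∀ x : Literature.Geometry.Lorentzian.Kerr.exterior M a, (x : Literature.Geometry.Lorentzian.E4) 0 = 0 → x ∉ K → ψ x = 0 ∧ mfderiv 𝓘(ℝ,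 Literature.Geometry.Lorentzian.E4) 𝓘(ℝ, ℝ) ψ x = 0) → ∀ τ : ℝ, 0 ≤ τ → Literature.Geometry.Lorentzian.sliceEnergy (Literature.Geometry.Lorentzian.Kerr.exterior M a) ψ τ ≤ C * ENNReal.ofReal ((1 - (a / M) ^ 2) ^ (-p)) * ∫⁻ y : Literature.Geometry.Lorentzian.E3, {y | Literature.Geometry.Lorentzian.E4.ofTimeSpace 0 y ∈ Literature.Geometry.Lorentzian.Kerr.exterior M a}.indicator (fun y ↦ ENNReal.ofReal (∑ m ∈ Finset.range (j + 1), ‖iteratedFDeriv ℝ m (Function.extend Subtype.val ψ (0 : Literature.Geometry.Lorentzian.E4 → ℝ)) (Literature.Geometry.Lorentzian.E4.ofTimeSpace 0 y)‖ ^ 2)) y) ∧ ∀ R : ℝ, ∃ C : ENNReal, C < ⊤ ∧ ∀ a : ℝ, Literature.Geometry.Lorentzian.Kerr.IsSubextremal M a → ∀ ψ : Literature.Geometry.Lorentzian.Kerr.exterior M a → ℝ, (ContMDiff 𝓘(ℝ, Literature.Geometry.Lorentzian.E4) 𝓘(ℝ, ℝ) ((⊤ : ℕ∞) : WithTop ℕ∞)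 ψ ∧ ∃ K : Set (Literature.Geometry.Lorentzian.Kerr.exterior M a), IsCompact K ∧ ∀ x : Literature.Geometry.Lorentzian.Kerr.exterior M a, (x : Literature.Geometry.Lorentzian.E4) 0 = 0 → x ∉ K → ψ x = 0 ∧ mfderiv 𝓘(ℝ, Literature.Geometry.Lorentzian.E4) 𝓘(ℝ, ℝ) ψ x = 0) → ∫⁻ τ in Ioi (0 : ℝ), Literature.Geometry.Lorentzian.localSliceEnergy (Literature.Geometry.Lorentzian.Kerr.exterior M a) ψ τ R ≤ C * ENNReal.ofReal ((1 - (a / M) ^ 2) ^ (-p)) * ∫⁻ y : Literature.Geometry.Lorentzian.E3, {y | Literature.Geometry.Lorentzian.E4.ofTimeSpace 0 y ∈ Literature.Geometry.Lorentzian.Kerr.exterior M a}.indicator (fun y ↦ ENNReal.ofReal (∑ m ∈ Finset.range (j + 1), ‖iteratedFDeriv ℝ m (Function.extend Subtype.val ψ (0 : Literature.Geometry.Lorentzian.E4 → ℝ)) (Literature.Geometry.Lorentzian.E4.ofTimeSpace 0 y)‖ ^ 2)) y) := by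
  intro h
  obtain ⟨p, j, ⟨C, -, hA⟩, -⟩ := h 1 one_pos
  obtain ⟨τ₀, hτ₀, hder⟩ := exists_deriv_prof_pos
  have key := hA 0 (by norm_num [Kerr.IsSubextremal]) psi psi_smooth_and_compactData τ₀ hτ₀
  rw [initEnergy_psi_eq_zero j, mul_zero] at key
  exact (sliceEnergy_pos hder).ne' (le_zero_iff.mp key)

end Summit.FinalStateConjecture.FinalStateConjecture.Theorems.KappaExplicitWaveDecay.Negative

end
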